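import Summits.KontsevichZagierPeriods.KontsevichZagierPeriods.Theorems.ValuedFieldSpecialisationParametricLiftingTightnessUnfibred
import Summits.KontsevichZagierPeriods.KontsevichZagierPeriods.Theorems.ValuedFieldSpecialisationParametricLiftingTightnessEscapingFamily

/-!
# Route ValuedFieldSpecialisation — crux `ParametricLifting` (stmt-KontsevichZagierPeriods-3498):
TIGHTNESS (b) — the domination clause is load-bearing

Helper (`--supports`) for item stmt-KontsevichZagierPeriods-3498 (line `registered`, lead c5). The net of
the crux `ParametricLifting`, and the hypothesis of its complement SF, consist of DOMINATED families
`KZ.IsDominatedFamily R r₀ g` — clause (1): an integrable envelope `g` near `s = z 0 → 0⁺`;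
clauses (2), (3): the a.e. special fibre `r₀` (eventual slice membership, convergence of the
integrands). This file certifies that clause (1) is LOAD-BEARING: with clauses (2), (3) alone —
"families with an a.e. special fibre" — SF is FALSE already for a single FIBRED change of variables
(`not_specialFibre_without_domination`).

The witness is the ESCAPING-MASS family `E = ({(s,u) | 0 < u < s < 1}, 1/s)` of the sibling file
`…TightnessEscapingFamily` (`exists_escapingFamily`): it is fibred-equivalent, by the shear
`u = s η`, to the constant family `c.cylinder = ((0,1)², 1)` over the unit interval `c = ((0,1), 1)`;
every slice of `E` has value `1` (the mass escapes to `u = 0`), but for EVERY `u` the point `(s,u)`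
leaves `E` as `s → 0⁺`, so `E` has the a.e. special fibre `∅` — and `[∅] − [c]` has value `−1`.
This is precisely the "error family that is neither dominated nor fibred-null" of the crux docstring,
in its simplest instance; clause (1) is what excludes it (`not_isDominatedFamily_escapingFamily` in
`…TightnessEscapingSlices`).

The theorem is first proved from the escaping pair as a HYPOTHESIS
(`not_specialFibre_without_domination_of`), then discharged by `exists_escapingFamily`.
No definition is introduced. Sources: M. Kontsevich, D. Zagier, *Periods* (2001), §1.2; H. Lebesgue's
dominated convergence theorem (the necessity of the envelope: `fₛ = s⁻¹ 𝟙_{(0,s)} → 0` pointwise with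
`∫ fₛ = 1`). The fibred/dominated vocabulary is this route's (`KZFibredRelations.lean`,
`KZDominatedFamily.lean`).
-/

noncomputable section

namespace Summit.KontsevichZagierPeriods.ValuedFieldSpecialisation

open MeasureTheory Set Filter
open scoped Topology
open Literature.NumberTheory.Transcendental Literature.NumberTheory.Transcendental.KZ
open Literature.ModelTheory.ExponentialFields (IsSemialgebraic)

/-- **Tightness (b), from an escaping pair.** If some family `E` with the escaping-mass shape
(`E.domain = {0 < u < s < 1}`, parameter `s = z 0`) is fibred-equivalent to the cylinder of the
unit interval `c = ((0,1), 1)`, then SF WITHOUT THE DOMINATION CLAUSE is false: the net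
`[E] − [c.cylinder]` is a fibred relation, `E` has the a.e. special fibre `∅` (for every `x`,
`(s, x) ∉ E.domain` once `s < x 0`), `c.cylinder` has the special fibre `c`, and `[∅] − [c]` has
value `−1 ≠ 0` (`KZ.relations_le_ker_eval_holds`). [Kontsevich–Zagier 2001, §1.2; Lebesgue]
[folklore] -/
theorem not_specialFibre_without_domination_of
    (hE : ∃ (c : IntegralRep 1) (E : IntegralRep 2),
      c.domain = {x | 0 < x 0 ∧ x 0 < 1} ∧ (c.integrand = fun _ => 1) ∧
      E.domain = {z | 0 < z 0 ∧ z 0 < 1 ∧ 0 < z 1 ∧ z 1 < z 0} ∧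
      (E.integrand = fun z => (z 0)⁻¹) ∧ of E - of c.cylinder ∈ fibredRelations) :
    ¬ ∀ (k : ℕ) (d : Fin k → ℕ) (m : Fin k → ℤ) (R : (i : Fin k) → IntegralRep (d i + 1))
      (r₀ : (i : Fin k) → IntegralRep (d i)),
      (∀ i, (∀ᵐ x : Fin (d i) → ℝ, ∀ᶠ s in nhdsWithin (0 : ℝ) (Set.Ioi 0),
          (Matrix.vecCons s x ∈ (R i).domain ↔ x ∈ (r₀ i).domain)) ∧
        (∀ᵐ x : Fin (d i) → ℝ, x ∈ (r₀ i).domain → Filter.Tendsto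
          (fun s : ℝ => (R i).integrand (Matrix.vecCons s x)) (nhdsWithin 0 (Set.Ioi 0))
          (nhds ((r₀ i).integrand x)))) →
      (∑ i, m i • of (R i)) ∈ fibredRelations → (∑ i, m i • of (r₀ i)) ∈ relations := by
  intro h
  obtain ⟨c, E, hcd, hci, hEd, -, hrel⟩ := hE
  -- clauses (2), (3) for `E → ∅` and for `c.cylinder → c`
  have hsf : ∀ i : Fin 2,
      (∀ᵐ x : Fin 1 → ℝ, ∀ᶠ s in nhdsWithin (0 : ℝ) (Set.Ioi 0),
          (Matrix.vecCons s x ∈ ((![E, c.cylinder] : Fin 2 → IntegralRep (1 + 1)) i).domain ↔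
            x ∈ ((![IntegralRep.empty 1, c] : Fin 2 → IntegralRep 1) i).domain)) ∧
        (∀ᵐ x : Fin 1 → ℝ, x ∈ ((![IntegralRep.empty 1, c] : Fin 2 → IntegralRep 1) i).domain →
          Filter.Tendsto (fun s : ℝ =>
            ((![E, c.cylinder] : Fin 2 → IntegralRep (1 + 1)) i).integrand (Matrix.vecCons s x))
            (nhdsWithin 0 (Set.Ioi 0))
            (nhds (((![IntegralRep.empty 1, c] : Fin 2 → IntegralRep 1) i).integrand x))) := by
    refine Fin.forall_fin_two.mpr ⟨⟨?_, ?_⟩,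
      ⟨c.isDominatedFamily_cylinder.2.1, c.isDominatedFamily_cylinder.2.2⟩⟩
    · refine Eventually.of_forall fun x => ?_
      simp only [Matrix.cons_val_zero, IntegralRep.domain_empty, mem_empty_iff_false, iff_false]
      by_cases hx : 0 < x 0
      · filter_upwards [Ioo_mem_nhdsGT hx] with s hs
        rw [hEd]
        simp only [mem_setOf_eq, Matrix.cons_val_zero, Matrix.cons_val_one, not_and, not_lt]
        exact fun _ _ _ => hs.2.le
      · refine Eventually.of_forall fun s => ?_
        rw [hEd]
        simp only [mem_setOf_eq, Matrix.cons_val_zero, Matrix.cons_val_one, not_and, not_lt]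
        exact fun _ _ h0 => (hx h0).elim
    · exact Eventually.of_forall fun x hx => (by simp at hx)
  have hnet := h 2 (fun _ => 1) ![1, -1] ![E, c.cylinder] ![IntegralRep.empty 1, c] hsf (by
    simp only [Fin.sum_univ_two, Matrix.cons_val_zero, Matrix.cons_val_one, one_zsmul, neg_zsmul,
      ← sub_eq_add_neg]
    exact hrel)
  -- the special-fibre class `[∅] − [c]` has value `−1`
  have hker := relations_le_ker_eval_holds hnet
  rw [AddMonoidHom.mem_ker] at hker
  simp only [Fin.sum_univ_two, Matrix.cons_val_zero, Matrix.cons_val_one, one_zsmul, neg_zsmul,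
    map_add, map_neg, eval_of, IntegralRep.value_empty, zero_add, neg_eq_zero] at hker
  have hval : c.value = 1 := by
    rw [c.value_eq_volume_real (fun x _ => by simp [hci]), Measure.real, hcd,
      isSemialgebraic_unitInterval_and_volume.2, ENNReal.toReal_one]
  rw [hval] at hker
  exact one_ne_zero hker

/-- **Tightness (b): without the domination clause, SF is false.** It is NOT true that the a.e.
special fibres of a FIBRED relation among families possessing a.e. special fibres (clauses (2),
(3) of `KZ.IsDominatedFamily`, clause (1) dropped) form a relation: the escaping-mass family
`E = ({0 < u < s < 1}, 1/s)` is fibred-equivalent to the cylinder of the unit interval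
(`exists_escapingFamily`), their a.e. special fibres are `∅` and `((0,1), 1)`, and `[∅] − [((0,1), 1)]`
has value `−1`. So the integrable envelope of clause (1) — Lebesgue's hypothesis — is exactly what
makes the special-fibre class of a fibred relation value-sound (`eval_specialFibre_eq_zero`) and is
load-bearing in both `ParametricLifting` (net) and `CTConstruction` (CT3).
[Kontsevich–Zagier 2001, §1.2; Lebesgue] [folklore] -/
theorem not_specialFibre_without_domination : ¬ ∀ (k : ℕ) (d : Fin k → ℕ) (m : Fin k → ℤ) (R : (i : Fin k) → KZ.IntegralRep (d i + 1)) (r₀ : (i : Fin k) → KZ.IntegralRep (d i)), (∀ i, (∀ᵐ x : Fin (d i) → ℝ, ∀ᶠ s in nhdsWithin (0 : ℝ) (Set.Ioi 0), (Matrix.vecCons s x ∈ (R i).domain ↔ x ∈ (r₀ i).domain)) ∧ (∀ᵐ x : Fin (d i) → ℝ, x ∈ (r₀ i).domain → Filter.Tendsto (fun s : ℝ => (R i).integrand (Matrix.vecCons s x)) (nhdsWithin 0 (Set.Ioi 0)) (nhds ((r₀ i).integrand x)))) → (∑ i, m i • KZ.of (R i)) ∈ KZ.fibredRelations → (∑ i,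 m i • KZ.of (r₀ i)) ∈ KZ.relations :=
  not_specialFibre_without_domination_of exists_escapingFamily

end Summit.KontsevichZagierPeriods.ValuedFieldSpecialisation
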